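import Summits.FinalStateConjecture.FinalStateConjecture.Theorems.EIHFluxBalanceInertialRecessionStubCoerMomQuantVar
import Summits.FinalStateConjecture.FinalStateConjecture.Theorems.EIHFluxBalanceInertialRecessionStubCoerMomQuantJets
import Summits.FinalStateConjecture.FinalStateConjecture.Theorems.EIHFluxBalanceInertialRecessionStubSlavingCOERCompactBoosts

/-!
# Route EIHFluxBalance — `InertialRecession` (E′), line `SketchCleanExcision`, skeleton r13,
# stub `stub_coerMomQuant` (Bs): the momentum rows of the modulated model — stabiliser
# invariance, homogeneity, and the normalisation of infinitesimal motions

Helper file for the crux `stmt-FinalStateConjecture-17403`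
(`Summit.FinalStateConjecture.FinalStateConjecture.Theses.EIHFluxBalance.InertialRecession`, E′),
registered stub `stub_coerMomQuant` (Bs) of skeleton r13. With `Var` the lab first-variation field
of a painted summand (`…StubCoerMomQuantVar`) and `G + x⁰Var` the first-order modulated model
(`…StubCoerMomQuantJets`):

* `coerMomQ_ricAt_add_stab` — the Ricci form of the modulated model at a point with positive
  painted radius is unchanged when a stabiliser motion (axial rotation rate / time translation)
  is added to `(A, d)` (`Var` itself is unchanged nearby; locality of `ricAt`);
* `coerMomQ_row_smul` — **homogeneity of the momentum rows in `(A, d)`**, from the linearity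
  clause (ML(i)) of the registered momentum-row lemma, taken as a hypothesis;
* `coerMomQ_exists_normal_complement` — a linear complement, inside the `η`-skew motions, of the
  Kerr–Schild stabiliser: every skew `(A, d)` is a stabiliser motion plus a normalised one, and a
  normalised motion with vanishing reduced size `‖Ae₀‖ + ‖d⃗‖ + ‖a·Ae₃‖` is zero;
* `coerMomQ_exists_lorentz_of_isometry`, `coerMomQ_radius_far` — bookkeeping: an `η`-isometric
  operator is `Λ⁻¹` for some `Λ ∈ O(1,3)` with the same Lorentz factor; far lab offsets have
  painted radius `> 2M` for every boost.

Elementary; no definitions, no named facts, no `sorry`.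
-/

set_option linter.dupNamespace false
set_option maxSynthPendingDepth 3

noncomputable section

open Set Function Filter Literature.Geometry.Lorentzian Literature.Geometry.Lorentzian.MetricCoord
open scoped Topology ContDiff

namespace Summit.FinalStateConjecture.FinalStateConjecture.Theorems.SublinearIsFree.Slaving

/-! ### Stabiliser invariance of the modulated model -/

/-- **Adding a stabiliser motion does not change the modulated model near a point with positive
painted radius**, hence not its Ricci form there: for `K` skew with `K e₀ = 0`,
`a ≠ 0 → K e₃ = 0` and `k⃗ = 0`, `Var_{(A+K, d+k)} = Var_{(A,d)}` on `{r(S·) > 0}`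
(`coerMomQ_var_stab_eq_zero`), and `ricAt` is local (`coerMomQ_ricAt_congr`).
[cite: ONeill1995, Ch. 2 §2.2] -/
theorem coerMomQ_ricAt_add_stab (G : E4 → E4 →L[ℝ] E4 →L[ℝ] ℝ) (M a : ℝ) (S A : E4 →L[ℝ] E4)
    (d : E4) {K : E4 →L[ℝ] E4} {k : E4}
    (hK : ∀ u w : E4, Minkowski.bilin (K u) w + Minkowski.bilin u (K w) = 0)
    (hK0 : K (E4.basisVector 0) = 0) (hK3 : a ≠ 0 → K (E4.basisVector 3) = 0)
    (hk : E4.spatial k = 0) {x : E4} (hx : 0 < Kerr.radius a (S x)) :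
    ricAt (fun z : E4 ↦ G z + (z 0) • ((fderiv ℝ (Kerr.bilin M a) (S z) ((A + K) (S z) + (d + k))).bilinearComp S S + (Kerr.bilin M a (S z)).bilinearComp ((A + K).comp S) S + (Kerr.bilin M a (S z)).bilinearComp S ((A + K).comp S))) x = ricAt (fun z : E4 ↦ G z + (z 0) • ((fderiv ℝ (Kerr.bilin M a) (S z) (A (S z) + d)).bilinearComp S S + (Kerr.bilin M a (S z)).bilinearComp (A.comp S) S + (Kerr.bilin M a (S z)).bilinearComp S (A.comp S))) x := by
  refine coerMomQ_ricAt_congr ?_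
  have hU : IsOpen {z : E4 | 0 < Kerr.radius a (S z)} :=
    isOpen_lt continuous_const ((Kerr.continuous_radius a).comp S.continuous)
  filter_upwards [hU.mem_nhds hx] with z hz
  rw [coerMomQ_var_add, coerMomQ_var_stab_eq_zero M a S hK hK0 hK3 hk hz, add_zero]

/-! ### Homogeneity of the momentum rows (from ML(i)) -/

set_option maxHeartbeats 400000 in
/-- **The momentum rows of the modulated model are homogeneous in the motion `(A, d)`.** At a
slice point `x` (`x⁰ = 0`) of the domain of the metric components `G`, with positive painted
radius, the rows of `G + x⁰Var_{(cA, cd)}` are `c` times those of `G + x⁰Var_{(A,d)}`: `Var` is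
linear in `(A, d)`, both modulated fields are metric components near `x` with the jets of
`coerMomQ_jets_add_slice_smul`, and the linearity clause ML(i) of the momentum-row lemma (the
hypothesis `hML`) applies with `n = dx⁰`. [folklore] -/
theorem coerMomQ_row_smul
    (hML : ∀ {G G₁ G₂ G₃ : E4 → E4 →L[ℝ] E4 →L[ℝ] ℝ} {V : Set E4} {x : E4} {n : E4 →L[ℝ] ℝ} {A₁ A₂ : E4 →L[ℝ] E4 →L[ℝ] ℝ} {P₁ P₂ : E4 →L[ℝ] E4 →L[ℝ] E4 →L[ℝ] ℝ} {W₁ W₂ W₃ : E4 →L[ℝ] E4 →L[ℝ] ℝ} (c₁ c₂ : ℝ), MetricCoord.IsMetricOn G V → MetricCoord.IsMetricOn G₁ V → MetricCoord.IsMetricOn G₂ V → MetricCoord.IsMetricOn G₃ V → x ∈ V → G₁ x = G x → G₂ x = G x → G₃ x = G x → fderiv ℝ G₁ x = fderiv ℝ G x + n.smulRight A₁ → fderiv ℝ G₂ x = fderiv ℝ G x + n.smulRight A₂ → fderiv ℝ G₃ x = fderiv ℝ G x + n.smulRight (c₁ • A₁ + c₂ • A₂) → (∀ v, fderiv ℝ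 (fderiv ℝ G₁) x v = fderiv ℝ (fderiv ℝ G) x v + (n v • P₁ + n.smulRight (P₁ v) + n v • n.smulRight W₁)) → (∀ v, fderiv ℝ (fderiv ℝ G₂) x v = fderiv ℝ (fderiv ℝ G) x v + (n v • P₂ + n.smulRight (P₂ v) + n v • n.smulRight W₂)) → (∀ v, fderiv ℝ (fderiv ℝ G₃) x v = fderiv ℝ (fderiv ℝ G) x v + (n v • (c₁ • P₁ + c₂ • P₂) + n.smulRight ((c₁ • P₁ + c₂ • P₂) v) + n v • n.smulRight W₃)) → ∀ e : E4, n e = 0 → MetricCoord.ricAt G₃ x (MetricCoord.sharpAt G x n) e - MetricCoord.ricAt G x (MetricCoord.sharpAt G x n) e = c₁ * (MetricCoord.ricAt G₁ x (MetricCoord.sharpAt G x n) e - MetricCoord.ricAt G x (MetricCoord.sharpAt G x n) e) + c₂ * (MetricCoord.ricAt G₂ x (MetricCoord.sharpAt G x n) e - MetricCoord.ricAt G x (MetricCoord.sharpAt G x n) e))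
    {G : E4 → E4 →L[ℝ] E4 →L[ℝ] ℝ} {V : Set E4} {x : E4} (hG : IsMetricOn G V) (hxV : x ∈ V)
    (hx0 : x 0 = 0) (M a : ℝ) (S A : E4 →L[ℝ] E4) (d : E4) (hx : 0 < Kerr.radius a (S x))
    (c : ℝ) (e : E4) (he : E4.dx 0 e = 0) :
    ricAt (fun z : E4 ↦ G z + (z 0) • ((fderiv ℝ (Kerr.bilin M a) (S z) ((c • A) (S z) + c • d)).bilinearComp S S + (Kerr.bilin M a (S z)).bilinearComp ((c • A).comp S) S + (Kerr.bilin M a (S z)).bilinearComp S ((c • A).comp S))) x (sharpAt G x (E4.dx 0)) e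
        - ricAt G x (sharpAt G x (E4.dx 0)) e
      = c * (ricAt (fun z : E4 ↦ G z + (z 0) • ((fderiv ℝ (Kerr.bilin M a) (S z) (A (S z) + d)).bilinearComp S S + (Kerr.bilin M a (S z)).bilinearComp (A.comp S) S + (Kerr.bilin M a (S z)).bilinearComp S (A.comp S))) x (sharpAt G x (E4.dx 0)) e
        - ricAt G x (sharpAt G x (E4.dx 0)) e) := by
  -- the first-variation field and its multiple
  obtain ⟨Φ, hΦ⟩ : ∃ Φ : E4 → E4 →L[ℝ] E4 →L[ℝ] ℝ, Φ = fun z ↦ ((fderiv ℝ (Kerr.bilin M a) (S z) (A (S z) + d)).bilinearComp S S + (Kerr.bilin M a (S z)).bilinearComp (A.comp S) S + (Kerr.bilin M a (S z)).bilinearComp S (A.comp S)) := ⟨_, rfl⟩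
  have h1 : (fun z : E4 ↦ G z + (z 0) • ((fderiv ℝ (Kerr.bilin M a) (S z) (A (S z) + d)).bilinearComp S S + (Kerr.bilin M a (S z)).bilinearComp (A.comp S) S + (Kerr.bilin M a (S z)).bilinearComp S (A.comp S))) = fun z ↦ G z + (z 0) • Φ z := by
    subst hΦ; rfl
  have h3 : (fun z : E4 ↦ G z + (z 0) • ((fderiv ℝ (Kerr.bilin M a) (S z) ((c • A) (S z) + c • d)).bilinearComp S S + (Kerr.bilin M a (S z)).bilinearComp ((c • A).comp S) S + (Kerr.bilin M a (S z)).bilinearComp S ((c • A).comp S))) = fun z ↦ G z + (z 0) • (c • Φ z) := by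
    subst hΦ
    funext z
    rw [coerMomQ_var_smul]
  rw [h1, h3]
  -- smoothness and symmetry of `Φ`, `c • Φ` on `U = {r(S·) > 0}`
  obtain ⟨hU, hΦc⟩ := coerMomQ_contDiffOn_var M a S A d
  rw [← hΦ] at hΦc
  have hcΦc : ContDiffOn ℝ ∞ (fun z ↦ c • Φ z) {z : E4 | 0 < Kerr.radius a (S z)} :=
    hΦc.const_smul c
  have hΦs : ∀ z ∈ {z : E4 | 0 < Kerr.radius a (S z)}, ∀ v w : E4, Φ z v w = Φ z w v :=
    fun z hz v w ↦ by rw [hΦ]; exact coerMomQ_var_symm M a S A d hz v w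
  have hcΦs : ∀ z ∈ {z : E4 | 0 < Kerr.radius a (S z)}, ∀ v w : E4,
      (c • Φ z) v w = (c • Φ z) w v := fun z hz v w ↦ by
    simp only [FunLike.coe_smul, Pi.smul_apply, smul_eq_mul, hΦs z hz v w]
  -- common domain on which `G`, `G + x⁰Φ`, `G + x⁰(cΦ)` are metric components
  have hpack₁ := coerMomQ_isMetricOn_add_slice_smul hG hxV hx0 hΦc hU hx hΦs
  obtain ⟨V₁, hV₁o, hxV₁, -, hV₁U, -, hG₁⟩ := hpack₁
  have hpack₃ := coerMomQ_isMetricOn_add_slice_smul hG hxV hx0 hcΦc hU hx hcΦs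
  obtain ⟨V₃, hV₃o, hxV₃, hV₃V, -, -, hG₃⟩ := hpack₃
  set V' : Set E4 := V₁ ∩ V₃ with hV'
  have hV'o : IsOpen V' := hV₁o.inter hV₃o
  have hxV' : x ∈ V' := ⟨hxV₁, hxV₃⟩
  have hG' : IsMetricOn G V' := coerMomQ_isMetricOn_mono hG hV'o fun z hz ↦ hV₃V hz.2
  have hG₁' : IsMetricOn (fun z : E4 ↦ G z + (z 0) • Φ z) V' :=
    coerMomQ_isMetricOn_mono hG₁ hV'o inter_subset_left
  have hG₃' : IsMetricOn (fun z : E4 ↦ G z + (z 0) • (c • Φ z)) V' :=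
    coerMomQ_isMetricOn_mono hG₃ hV'o inter_subset_right
  -- the jets at `x`
  have hV'U : V' ⊆ {z : E4 | 0 < Kerr.radius a (S z)} := fun z hz ↦ hV₁U hz.1
  have hjets₁ := coerMomQ_jets_add_slice_smul hG'.contDiffOn (hΦc.mono hV'U) hV'o hxV' hx0
  obtain ⟨h10, h11, h12⟩ := hjets₁
  have hjets₃ := coerMomQ_jets_add_slice_smul hG'.contDiffOn (hcΦc.mono hV'U) hV'o hxV' hx0
  obtain ⟨h30, h31, h32⟩ := hjets₃
  have hdΦ : DifferentiableAt ℝ Φ x :=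
    (hΦc.contDiffAt (hU.mem_nhds hx)).differentiableAt (by simp)
  have hDc : fderiv ℝ (fun z ↦ c • Φ z) x = c • fderiv ℝ Φ x := fderiv_const_smul hdΦ c
  set n : E4 →L[ℝ] ℝ := E4.dx 0 with hn
  set A₁ : E4 →L[ℝ] E4 →L[ℝ] ℝ := Φ x with hA₁
  set P₁ : E4 →L[ℝ] E4 →L[ℝ] E4 →L[ℝ] ℝ := fderiv ℝ Φ x with hP₁
  have h31' : fderiv ℝ (fun z : E4 ↦ G z + (z 0) • (c • Φ z)) x =
      fderiv ℝ G x + n.smulRight (c • A₁ + (0 : ℝ) • A₁) := by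
    rw [zero_smul ℝ A₁, add_zero, h31]
  have h32' : ∀ v, fderiv ℝ (fderiv ℝ (fun z : E4 ↦ G z + (z 0) • (c • Φ z))) x v =
      fderiv ℝ (fderiv ℝ G) x v + (n v • (c • P₁ + (0 : ℝ) • P₁)
        + n.smulRight ((c • P₁ + (0 : ℝ) • P₁) v)
        + n v • n.smulRight (0 : E4 →L[ℝ] E4 →L[ℝ] ℝ)) := by
    intro v
    rw [zero_smul ℝ P₁, add_zero, h32 v, hDc]
  have h := hML c 0 hG' hG₁' hG₁' hG₃' hxV' h10 h10 h30 h11 h11 h31' h12 h12 h32' e he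
  rw [h, zero_mul, add_zero]

/-! ### Normalisation of infinitesimal motions modulo the stabiliser -/

/-- **A linear complement of a subspace inside a subspace** (bookkeeping form of
`Submodule.exists_isCompl`): for `K ≤ X` there is `Y ≤ X` with `X = K + Y` and `K ∩ Y = 0`.
[folklore] -/
theorem coerMomQ_exists_compl_le {F : Type*} [AddCommGroup F] [Module ℝ F]
    (X K : Submodule ℝ F) :
    ∃ Y : Submodule ℝ F, Y ≤ X ∧ (∀ x ∈ X, ∃ k ∈ K, ∃ y ∈ Y, x = k + y) ∧
      ∀ y ∈ Y, y ∈ K → y = 0 := by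
  set K' : Submodule ℝ X := K.comap X.subtype with hK'
  obtain ⟨Y', hY'⟩ := K'.exists_isCompl
  refine ⟨Y'.map X.subtype, Submodule.map_subtype_le X Y', fun x hx ↦ ?_, fun y hy hyK ↦ ?_⟩
  · have htop : (⟨x, hx⟩ : X) ∈ K' ⊔ Y' := by rw [hY'.sup_eq_top]; trivial
    obtain ⟨k, hk, y, hy, hky⟩ := Submodule.mem_sup.mp htop
    refine ⟨(k : F), hk, (y : F), ⟨y, hy, rfl⟩, ?_⟩
    have h := congrArg Subtype.val hky
    simpa using h.symm
  · obtain ⟨y', hy', rfl⟩ := hy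
    have hyK' : y' ∈ K' := hyK
    have h0 : y' ∈ K' ⊓ Y' := ⟨hyK', hy'⟩
    rw [hY'.inf_eq_bot, Submodule.mem_bot] at h0
    simp [h0]

/-- **Normalisation of `η`-skew infinitesimal motions modulo the Kerr–Schild stabiliser.** There
is a linear subspace `Y` of pairs `(A, d)` (a complement of the stabiliser
`{(K, k) | K skew, K e₀ = 0, a ≠ 0 → K e₃ = 0, k⃗ = 0}` inside the skew motions) such that:
its elements are skew; every skew `(A, d)` is a stabiliser motion plus an element of `Y`; and an
element of `Y` with `A e₀ = 0`, `d⃗ = 0`, `a • A e₃ = 0` is zero. [folklore] -/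
theorem coerMomQ_exists_normal_complement (a : ℝ) :
    ∃ Y : Submodule ℝ ((E4 →L[ℝ] E4) × E4),
      (∀ p ∈ Y, ∀ u w : E4, Minkowski.bilin (p.1 u) w + Minkowski.bilin u (p.1 w) = 0) ∧
      (∀ (A : E4 →L[ℝ] E4) (d : E4),
        (∀ u w : E4, Minkowski.bilin (A u) w + Minkowski.bilin u (A w) = 0) →
        ∃ (K : E4 →L[ℝ] E4) (k : E4),
          (∀ u w : E4, Minkowski.bilin (K u) w + Minkowski.bilin u (K w) = 0) ∧
          K (E4.basisVector 0) = 0 ∧ (a ≠ 0 → K (E4.basisVector 3) = 0) ∧ E4.spatial k = 0 ∧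
          ((A - K, d - k) : (E4 →L[ℝ] E4) × E4) ∈ Y) ∧
      (∀ p ∈ Y, p.1 (E4.basisVector 0) = 0 → E4.spatial p.2 = 0 →
        a • p.1 (E4.basisVector 3) = 0 → p = 0) := by
  -- the skew motions `X` and the stabiliser `K₀ ≤ X`
  set X : Submodule ℝ ((E4 →L[ℝ] E4) × E4) :=
    { carrier := {p | ∀ u w : E4, Minkowski.bilin (p.1 u) w + Minkowski.bilin u (p.1 w) = 0}
      add_mem' := fun {p q} hp hq u w ↦ by
        simp only [Prod.fst_add, _root_.add_apply, map_add]
        linear_combination hp u w + hq u w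
      zero_mem' := fun u w ↦ by simp
      smul_mem' := fun c p hp u w ↦ by
        simp only [Prod.smul_fst, map_smul, smul_eq_mul, _root_.smul_apply]
        linear_combination c * hp u w } with hX
  set K₀ : Submodule ℝ ((E4 →L[ℝ] E4) × E4) :=
    { carrier := {p | (∀ u w : E4, Minkowski.bilin (p.1 u) w + Minkowski.bilin u (p.1 w) = 0) ∧
        p.1 (E4.basisVector 0) = 0 ∧ a • p.1 (E4.basisVector 3) = 0 ∧ E4.spatial p.2 = 0}
      add_mem' := fun {p q} hp hq ↦ by
        refine ⟨fun u w ↦ ?_, ?_, ?_, ?_⟩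
        · simp only [Prod.fst_add, _root_.add_apply, map_add]
          linear_combination hp.1 u w + hq.1 u w
        · simp [hp.2.1, hq.2.1]
        · simp only [Prod.fst_add, _root_.add_apply, smul_add, hp.2.2.1, hq.2.2.1, add_zero]
        · simp [hp.2.2.2, hq.2.2.2]
      zero_mem' := by
        refine ⟨fun u w ↦ by simp, by simp, by simp, by simp⟩
      smul_mem' := fun c p hp ↦ by
        refine ⟨fun u w ↦ ?_, ?_, ?_, ?_⟩
        · simp only [Prod.smul_fst, map_smul, smul_eq_mul, _root_.smul_apply]
          linear_combination c * hp.1 u w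
        · simp [hp.2.1]
        · simp only [Prod.smul_fst, FunLike.coe_smul, Pi.smul_apply, smul_comm a c,
            hp.2.2.1, smul_zero]
        · simp [hp.2.2.2] } with hK₀
  obtain ⟨Y, hYX, hdec, hdisj⟩ := coerMomQ_exists_compl_le X K₀
  refine ⟨Y, fun p hp ↦ hYX hp, fun A d hA ↦ ?_, fun p hp h0 hd h3 ↦ ?_⟩
  · obtain ⟨k, hk, y, hy, hky⟩ := hdec (A, d) hA
    refine ⟨k.1, k.2, hk.1, hk.2.1, fun ha ↦ ?_, hk.2.2.2, ?_⟩
    · have h := hk.2.2.1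
      rcases smul_eq_zero.mp h with h | h
      · exact absurd h ha
      · exact h
    · have hy' : ((A - k.1, d - k.2) : (E4 →L[ℝ] E4) × E4) = y := by
        rw [show ((A - k.1, d - k.2) : (E4 →L[ℝ] E4) × E4) = (A, d) - k from rfl, hky]
        abel
      rw [hy']
      exact hy
  · exact hdisj p hp ⟨hYX hp, h0, h3, hd⟩

/-! ### Bookkeeping: Lorentz operators and far offsets -/

/-- **An `η`-isometric operator is `Λ⁻¹` for some `Λ ∈ O(1,3)`**, with the same Lorentz factor
`(Λe₀)⁰ = (Se₀)⁰` (`lorentz_symm_apply_basisVector_zero`). [cite: ONeill1983, Ch. 9, p. 233] -/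
theorem coerMomQ_exists_lorentz_of_isometry {S : E4 →L[ℝ] E4}
    (hS : ∀ v w, Minkowski.bilin (S v) (S w) = Minkowski.bilin v w) :
    ∃ L : lorentzGroup, ((L : E4 ≃L[ℝ] E4).symm : E4 →L[ℝ] E4) = S ∧
      ((L : E4 ≃L[ℝ] E4) (E4.basisVector 0)) 0 = S (E4.basisVector 0) 0 := by
  let Λ : lorentzGroup := ⟨LinearEquiv.toContinuousLinearEquiv
      (LinearEquiv.ofInjectiveEndo (S : E4 →ₗ[ℝ] E4) (injective_of_minkowski_isometry hS)),
    fun v w ↦ hS v w⟩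
  have hcoe : (((Λ : lorentzGroup) : E4 ≃L[ℝ] E4) : E4 →L[ℝ] E4) = S := by
    ext v; rfl
  refine ⟨Λ⁻¹, ?_, ?_⟩
  · rw [coe_lorentz_inv, ContinuousLinearEquiv.symm_symm, hcoe]
  · rw [coe_lorentz_inv, lorentz_symm_apply_basisVector_zero Λ]
    rfl

/-- **Far lab offsets have large painted radius, for every boost**: `‖y‖ ≥ |a| + (2M + 1)` gives
`r_a(Λ⁻¹(0, y)) > 2M` (`le_radius_poincareInv_of_le`). [folklore] -/
theorem coerMomQ_radius_far {M : ℝ} (hM : 0 ≤ M) (a : ℝ) (L : lorentzGroup) {y : E3}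
    (hy : |a| + (2 * M + 1) ≤ ‖y‖) :
    2 * M < Kerr.radius a (poincareInv L 0 (E4.ofTimeSpace 0 y)) := by
  have h := sq_sub_sq_le_radius_poincareInv_sq L a 0 0 (x := E4.ofTimeSpace 0 y) (by simp)
  have h0 : E4.ofTimeSpace 0 (0 : E3) = 0 := by
    ext i
    refine Fin.cases ?_ (fun j ↦ ?_) i
    · simp
    · simp
  rw [h0, E4.spatial_ofTimeSpace, sub_zero] at h
  have hr := Kerr.radius_nonneg a (poincareInv L 0 (E4.ofTimeSpace 0 y))
  have ha := abs_nonneg a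
  have h1 : (|a| + (2 * M + 1)) ^ 2 ≤ ‖y‖ ^ 2 := pow_le_pow_left₀ (by positivity) hy 2
  nlinarith [sq_abs a]

/-- **Registered one-line carrier form** (`coerMomQ_radius_far_bs`) of `coerMomQ_radius_far`: far
lab offsets have painted radius `> 2M` for every boost. [folklore] -/
theorem coerMomQ_radius_far_bs : open Literature.Geometry.Lorentzian in ∀ {M : ℝ}, 0 ≤ M → ∀ (a : ℝ) (L : lorentzGroup) {y : E3}, |a| + (2 * M + 1) ≤ ‖y‖ → 2 * M < Kerr.radius a (poincareInv L 0 (E4.ofTimeSpace 0 y)) :=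
  fun hM a L _ hy ↦ coerMomQ_radius_far hM a L hy

end Summit.FinalStateConjecture.FinalStateConjecture.Theorems.SublinearIsFree.Slaving

end
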